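import Summits.Ventures.YMGap.Thresholds.StarTransferZd
import Summits.Ventures.YMGap.Thresholds.StarWindowBoundLemmaG
import Summits.Ventures.YMGap.Thresholds.StarLimitClustering
import Summits.Ventures.YMGap.Thresholds.SharpStrongCoupling
import HarnessLib

/-!
# Venture YMGap — track (c) «DS»: THE INFINITE-VOLUME ROW for `SU(2)`, `d = 4` at every `β_W ≤ 9/25` —
# DLR uniqueness, unique thermodynamic limit, and mass gap of the unique state (JOIN file, PLAN R108)

HONEST FRAMING: venture file (cell `pub-ymgap`), strong-coupling LATTICE statements for `SU(2)` lattice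
Yang–Mills on `ℤ^4` with the Wilson action at Wilson coupling `β_W = 4/g² ≤ 9/25` ('t Hooft `β = β_W/4 ≤ 9/100`,
tree bare coupling `β_W/2`); nothing about the continuum, confinement at weak coupling, or the Millennium
problem. NO hypothesis is left: this file only JOINS tree theorems — the cell's Lemma G
(`StarLemmaG.starWindowBound_lemmaG`, ds-4: the vertex-star window bound on every torus `L ≥ 3`,
`0 ≤ β_W ≤ 1/2`, received sum `R_G(β_W) = 6c(1+c)/(1−4c−6c²)`, `c = β_W/4`, `< 1` iff `β_W < 0.3609…`), the
torus → `ℤ^4` transfer and uniqueness door (`DSWindowZd.su2_hasUniqueGibbsMeasure_of_starWindowBound`, ds-1),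
and the clustering of the limit states (`StarLimit.su2_massGapAt_le_9_100_of_lemmaG_of_unique`, ds-2).

* `su2_hasUniqueGibbsMeasure_le_9_25` — `|𝒢| = 1` for the infinite-volume specification at every `0 ≤ β_W ≤ 9/25`;
* `su2_hasUniqueInfiniteVolumeLimit_le_9_25` — the torus Wilson states converge (full sequence) to it;
* `su2_massGapAt_le_9_100` — `MassGapAt 4 2 β` (unique DLR state + exponential clustering, the track-(a)
  currency of `ImprovedThreshold`) at every 't Hooft `0 ≤ β ≤ 9/100`.
-/

noncomputable section

open Literature.Probability.LatticeModels
open Literature.MathematicalPhysics.QuantumLattice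
open Literature.MathematicalPhysics.QuantumFieldTheory (suFrobDist)
open Summit.Ventures.YMGap.StarWindowGauge (gaugeR gaugeR_lt_one_of_le)
open Summit.Ventures.YMGap.StarLemmaG (starWindowBound_lemmaG)
open Summit.Ventures.YMGap.StarWindowGauge (Delta_pos)

namespace Summit.Ventures.YMGap.DSWindowZd

/-- `0 ≤ R_G(β)` for `0 ≤ β ≤ 7/10` (numerator `≥ 0`, `Δ(β/4) > 0`). -/
private theorem gaugeR_nonneg' {β : ℝ} (h0 : 0 ≤ β) (h1 : β ≤ 7 / 10) : 0 ≤ gaugeR β := by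
  unfold gaugeR
  exact div_nonneg (by positivity) (Delta_pos (by positivity) (by linarith)).le

/-- **DLR UNIQUENESS for `SU(2)`, `d = 4`, at every `0 ≤ β_W ≤ 9/25`** (unconditional): the infinite-volume
Wilson specification `ymSpecification (fundamentalRep (Fin 2)) (2·(β_W/4))` on `ℤ^4` has exactly one DLR state —
Lemma G on the torus of side `5` + the torus → `ℤ^4` transfer + the Dobrushin–Shlosman uniqueness door. -/
theorem su2_hasUniqueGibbsMeasure_le_9_25 {βW : ℝ} (h0 : 0 ≤ βW) (h : βW ≤ 9 / 25) :
    HasUniqueGibbsMeasure (ymSpecification (d := 4) (fundamentalRep (Fin 2)) ((2 : ℕ) * (βW / 4))) :=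
  su2_hasUniqueGibbsMeasure_of_starWindowBound (L := 5) le_rfl βW (gaugeR_nonneg' h0 (by linarith))
    (gaugeR_lt_one_of_le h0 h) (starWindowBound_lemmaG (by norm_num) h0 (by linarith))

/-- **The thermodynamic limit exists and is unique** at every `0 ≤ β_W ≤ 9/25`: the full sequence of torus
Wilson states converges on bounded continuous cylinder observables, to the unique DLR state. -/
theorem su2_hasUniqueInfiniteVolumeLimit_le_9_25 {βW : ℝ} (h0 : 0 ≤ βW) (h : βW ≤ 9 / 25) :
    HasUniqueInfiniteVolumeLimit (d := 4) (fundamentalRep (Fin 2)) (βW / 2) :=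
  su2_hasUniqueInfiniteVolumeLimit_of_starWindowBound (L := 5) le_rfl βW (gaugeR_nonneg' h0 (by linarith))
    (gaugeR_lt_one_of_le h0 h) (starWindowBound_lemmaG (by norm_num) h0 (by linarith))

/-- **MASS GAP OF THE UNIQUE STATE at every 't Hooft coupling `0 ≤ β ≤ 9/100`** (`MassGapAt 4 2 β`: unique DLR
state and exponential clustering of Lipschitz cylinder observables — the currency of track (a)'s
`ImprovedThreshold 4 N (1/32)`): ds-2's limit-state clustering `su2_massGapAt_le_9_100_of_lemmaG_of_unique` fed with
Lemma G and the uniqueness theorem above (`β_W = 4β ≤ 9/25`). -/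
theorem su2_massGapAt_le_9_100 {β : ℝ} (h0 : 0 ≤ β) (h : β ≤ 9 / 100) : MassGapAt 4 2 β := by
  have huniq := su2_hasUniqueGibbsMeasure_le_9_25 (βW := 4 * β) (by linarith) (by linarith)
  have e : (((2 : ℕ) : ℝ)) * (4 * β / 4) = 2 * β := by push_cast; ring
  rw [e] at huniq
  exact StarLimit.su2_massGapAt_le_9_100_of_lemmaG_of_unique
    (fun L _ hL βW h0' h' => starWindowBound_lemmaG hL h0' (by linarith)) h0 h huniq

/-- **THE STRONG-COUPLING PHASE PREDICATE at every `0 ≤ β_W ≤ 9/25`** (`StrongCouplingPhaseAt 4 2 (β_W/2)`: the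
β-body of the tree's named fact `shenZhuZhu_strongCoupling` — periodic `SU(2)` states converge along the full
sequence to a translation-invariant state, every free-boundary limit equals it, plaquette covariances decay
exponentially; track (a) reaches it K-conditionally on three printed facts at `β_W < 1/8`,
`HessianSharp.sharp_strongCouplingPhase`): from `su2_massGapAt_le_9_100` by p2's unconditional
`HessianSharp.strongCouplingPhaseAt_of_massGapAt`. -/
theorem su2_strongCouplingPhaseAt_le_9_25 {βW : ℝ} (h0 : 0 ≤ βW) (h : βW ≤ 9 / 25) :
    HessianSharp.StrongCouplingPhaseAt 4 2 (βW / 2) := by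
  refine HessianSharp.strongCouplingPhaseAt_of_massGapAt (by norm_num) (by norm_num) ?_
  have e : βW / 2 / (2 : ℕ) = βW / 4 := by push_cast; ring
  rw [e]
  exact su2_massGapAt_le_9_100 (by linarith) (by linarith)

end Summit.Ventures.YMGap.DSWindowZd

end
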